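import Summits.BirchSwinnertonDyer.BirchSwinnertonDyer.Theorems.AdditiveKolyvaginRoadKolyvaginPrimitiveOfLowerHalvesOverQ
import Summits.BirchSwinnertonDyer.BirchSwinnertonDyer.Theorems.AdditiveKolyvaginRoadSpadeOneTwistTransport
import Summits.BirchSwinnertonDyer.Rank1Residual.Additive.QuadraticTwistSurj
import Literature.NumberTheory.EllipticCurves.ModularSymbols
import Literature.NumberTheory.EllipticCurves.BSDInvariants
import Literature.NumberTheory.EllipticCurves.TamagawaFiniteIndexProofs
import HarnessLib

/-!
# Route `AdditiveKolyvaginRoad`, crux KS′ `LevelKolyvaginSystemsAdditive` (item stmt-BirchSwinnertonDyer-21396) ≡ KPA′ (21400):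
# the KURIHARA ROAD to the lower half LOW₀ — TRANSFER BY NAME of crux card `kurihara-lower-half` into the socket p638284
# (cell `pub/bsd-wall`, width seat `bsd-wall-akr-p2x-w4` g6; `--supports stmt-BirchSwinnertonDyer-21396`, helper)

THEOREMS ONLY (no definition, no named fact, no `sorry`).  BSD is not proved by any of this; KS′ and KPA′ stay OPEN at `p² ∣ N`; the
Kim–Nakamura theorem is NOT asserted (it enters as a displayed hypothesis `hKN`), and Kurihara's non-vanishing conjecture is NOT
asserted (displayed hypothesis `hC`).

THE POINT.  The residual of the crux above the bottom is, by the tree's socket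
`AdditiveKoly.exists_kolyvaginClass_ne_zero_of_lowerHalves` (p638284), the two LOWER halves of `BSD_p` over `ℚ` in Miller currency
(`Typed.MissingLowerBoundAt`): LOW₁ for `E` (♯ rank-one row) and LOW₀ for every globally minimal model `Wd` of the twist `E^{(d_K)}`
(non-CM, additive at `p`, analytic rank `0`) — the socket's binder `hlowTw`.  The crux-ideation card
`Cruxes/LevelKolyvaginSystemsAdditive/Ideas/kurihara-lower-half.md` (round 1, seat 2 g19) proposes for LOW₀ the KURIHARA ROAD:
Kim–Nakamura (arXiv:1808.07726, Thm 1.7 + Rem. 1.8(1)) «at an additive `p > 7` with `ρ̄` onto, `p ∤ Tam(E)·∏_{ℓ mult}(ℓ∓1)`, Manin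
constant prime to `p`, `L(E,1) ≠ 0`: a `p`-adic UNIT Kurihara number `δ_n` gives `ord_p #Ш = ord_p L(E,1)/Ω`», typed in the card's sketch
(`RamifiedHabitatKuriharaSlotSketch.lean` §2) as the implication `KuriharaLowerHalf.KimNakamuraToLowerHalf` INTO `MissingLowerBoundAt`,
with the residual C⁺ = `KuriharaLowerHalf.KuriharaNonvanishingRankZeroAdditive` («every non-CM additive rank-0 row with `ρ̄` onto has a
unit Kurihara number»).  The card's Transfer paragraph: «C⁺ ⟹ LOW₀ on the ♯-type rank-0 rows … the twists `E^{(d_K)}` inherit `ρ̄` onto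
and the additive type».  This file PROVES that transfer, BY NAME, at every ♯ frame:

* §1 `twist_binders_of_frame` — at a ♯ frame (`p ∣ N` additive, `ρ̄_{E,p}` onto, `p ∤ ∏ c_ℓ(E)`, `E` non-CM, `K` imaginary quadratic
  with `d_K` odd satisfying the Heegner hypothesis for `N_E`, `L(E^{(d_K)},1) ≠ 0`, modularity) EVERY model `Wd = Cd • E^{(d_K)}` is
  non-CM, additive at `p`, of analytic rank `0` (`AdditiveKolyvaginKernel.twist_nonCM_addv_rankZero`), has `ρ̄_{Wd,p}` onto
  (`Rank1Residual.Additive.surj_iff_of_model_twist`), `p ∤ ∏ c_ℓ(Wd)` (`X2.padicValNat_tamagawaProduct_twist_of_heegner_of_odd`), and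
  every multiplicative prime of `Wd` is multiplicative for `E` (`QuadraticDescent.mult_of_model_heegnerTwist_of_mult`, w3 g11) — so
  Kim–Nakamura's binder «`p ∤ (ℓ−1)(ℓ+1)` at the multiplicative `ℓ` of `Wd`» is the SAME binder for `E`.
* §2 `lowerHalf_twist_of_kuriharaRoad` — THE DOOR.  Hypotheses: a Kim–Nakamura-SHAPED implication `hKN` (the sketch's
  `KimNakamuraToLowerHalf` at the prime `p`, with its Kurihara clause «∃ n g dl, IsKuriharaLevel … ∧ unit δ_n» ABSTRACTED to an arbitrary
  predicate `Kur X Dt ms` — the Cruxes sketch is not importable from `Theorems/`, and the door does not depend on what the clause says),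
  a C⁺-SHAPED supply `hC` (the sketch's `KuriharaNonvanishingRankZeroAdditive` at `p`, same abstraction), the frame, `7 < p`,
  «`p ∤ (ℓ−1)(ℓ+1)` at every multiplicative prime `ℓ` of `E`» (Kim–Nakamura's non-anomaly binder, NOT a ♯ binder), and a Manin-good
  parametrisation of each minimal twist model with a rational plus modular symbol (`hDt`: `∃ Dt′, p ∤ c(Dt′)`, `Re{∞,r}_f = ms(r)·Ω⁺`;
  PUB-type: modularity + Manin + Manin–Drinfeld).  Conclusion: the socket's `hlowTw` VERBATIM — `Typed.MissingLowerBoundAt Wd p` for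
  every globally minimal model `Wd = Cd • E^{(d_K)}`.  A consumer instantiates `Kur :=` the sketch's Kurihara clause,
  `hKN := KimNakamuraToLowerHalf` (once a Literature port makes it a named fact) and `hC :=` C⁺.
* §3 `exists_kolyvaginClass_ne_zero_of_lowerHalf_of_kuriharaRoad` — the frame corollary through p638284: at a ♯ frame with `7 < p` and the
  non-anomaly binder, PUB (`gross_zagier`, `kolyvagin`, Kolyvagin's bound, GZK, modularity, McCallum Cor. 5.6) + LOW₁ for `E` + the
  Kurihara road (`hKN`, `hC`, `hDt`) ⟹ some Kolyvagin–Heegner datum at some Kolyvagin level has a non-zero mod-`p` class — the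
  conclusion of KPA′ ∕ of the line's stub `stub_kolyvaginPrimitiveAboveBottom` at that frame.  LOW₁ stays a binder: the card is
  LOW₀-only («pairs with any LOW₁ module»).

HONEST FRAMING: conditional on every displayed binder; frames with `p ∈ {5, 7}` are NOT served by this door (Kim–Nakamura's exceptional
classes, card: «not typed here»); nothing is booked.  References (locators only): [cite: KimNakamura2020, Thm 1.7, Rem. 1.8] =
arXiv:1808.07726; [cite: JetchevSkinnerWan2017, §7.4.1, §7.4.3]; [cite: McCallumLMS1991, §5 Cor. 5.6]; [cite: WZhang2014, Thm. 1.1].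
-/

-- single-conjunct summit: `Summit.BirchSwinnertonDyer.BirchSwinnertonDyer.…` repeats the name by design
set_option linter.dupNamespace false
set_option autoImplicit false

noncomputable section

open scoped Classical

namespace Summit.BirchSwinnertonDyer.BirchSwinnertonDyer.Theorems.AdditiveKoly.KuriharaRoad

open WeierstrassCurve NumberField
  Literature.NumberTheory.EllipticCurves Literature.NumberTheory.EllipticCurves.ModularForms
  Literature.NumberTheory.EllipticCurves.Rank1Residual Literature.NumberTheory.EllipticCurves.Rank1Residual.Typed
  Summit.BirchSwinnertonDyer.Rank1Residual Summit.BirchSwinnertonDyer.Rank1Residual.X11b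
  Summit.BirchSwinnertonDyer.Rank1Residual.X11b.Three
  Summit.BirchSwinnertonDyer.BirchSwinnertonDyer.Theorems.AdditiveKolyvaginKernel

variable (W : WeierstrassCurve ℚ) [W.IsElliptic] [W.IsGloballyMinimal]
  (p : ℕ) [hp : Fact p.Prime] (K : Type) [Field K] [NumberField K]

/-! ## §1 The twist inherits the frame's binders -/

/-- **The minimal twist models inherit the ♯ binders.**  At a frame — `E = W/ℚ` globally minimal, additive at `p` (`hadd`) with
`ρ̄_{E,p}` onto (`hs`), non-CM (`hCM`), `p ≠ 2`, `p ∤ ∏ c_ℓ(E)` (`htam`); `K` imaginary quadratic with `d_K` odd and the Heegner hypothesis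
for `N_E`; `L(E^{(d_K)},1) ≠ 0`; modularity `hmod` — every model `Wd = Cd • E^{(d_K)}` is non-CM, additive at `p`, of analytic rank `0`,
has `ρ̄_{Wd,p}` onto, `p ∤ ∏ c_ℓ(Wd)`, and each of its multiplicative primes is multiplicative for `E`.  (`p ∣ N_E` splits in `K`, so
`p ∤ d_K`: the twist is a unit twist at `p`; the Tamagawa valuations agree by `X2.padicValNat_tamagawaProduct_twist_of_heegner_of_odd`.)
[cite: JetchevSkinnerWan2017, §7.4.1 (eq:tamK)] -/
theorem twist_binders_of_frame (hmod : hasEntireLFunction_rat) (hp2 : p ≠ 2) (hadd : Addv W p)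
    (hs : W.HasSurjectiveModNGaloisRep p) (hCM : ¬ W.HasCM) (htam : ¬ p ∣ W.tamagawaProduct)
    (hK : IsImaginaryQuadratic K) (hodd : Odd (NumberField.discr K)) (hH : SatisfiesHeegnerHypothesis (W.conductorNorm ℤ) K)
    (hL : (W.quadraticTwist (NumberField.discr K : ℚ)).entireLFunction 1 ≠ 0)
    (Wd : WeierstrassCurve ℚ) [Wd.IsElliptic] (Cd : VariableChange ℚ)
    (hWd : Cd • W.quadraticTwist (NumberField.discr K : ℚ) = Wd) :
    ¬ Wd.HasCM ∧ Addv Wd p ∧ Wd.analyticRank = 0 ∧ Wd.HasSurjectiveModNGaloisRep p ∧ ¬ p ∣ Wd.tamagawaProduct ∧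
      ∀ (ℓ : ℕ) [Fact ℓ.Prime], Wd.HasMultiplicativeReductionAtPrime ℓ → W.HasMultiplicativeReductionAtPrime ℓ := by
  have hpP : p.Prime := hp.out
  obtain ⟨hCMd, haddd, hr0⟩ := twist_nonCM_addv_rankZero hmod W p hCM hadd K hK hH hL Wd Cd hWd
  have hD0 : (NumberField.discr K : ℚ) ≠ 0 := by exact_mod_cast NumberField.discr_ne_zero K
  -- `ρ̄` onto passes to the twist
  have hsd : Wd.HasSurjectiveModNGaloisRep p :=
    (Additive.surj_iff_of_model_twist W p hD0 ⟨Cd, hWd⟩).mpr hs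
  -- `p ∣ N` splits in `K`, so `p ∤ d_K`; Tamagawa valuations agree
  have hpN : p ∣ W.conductorNorm ℤ := (W.dvd_conductorNorm_iff_not_hasGoodReductionAtPrime p).mpr hadd.1
  have hpd : ¬ (p : ℤ) ∣ NumberField.discr K := Literature.SatisfiesHeegnerHypothesis.not_dvd_discr hK.1 hH hpP hpN
  have htamEq : padicValNat p Wd.tamagawaProduct = padicValNat p W.tamagawaProduct :=
    X2.padicValNat_tamagawaProduct_twist_of_heegner_of_odd W p hp2 K hK hodd hpd hH Cd hWd
  have htamd : ¬ p ∣ Wd.tamagawaProduct := by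
    intro hdvd
    have h0 : padicValNat p W.tamagawaProduct = 0 := padicValNat.eq_zero_of_not_dvd htam
    have h1 : 1 ≤ padicValNat p Wd.tamagawaProduct :=
      one_le_padicValNat_of_dvd (Wd.tamagawaProduct_pos').ne' hdvd
    omega
  exact ⟨hCMd, haddd, hr0, hsd, htamd,
    fun ℓ _ hm ↦ QuadraticDescent.mult_of_model_heegnerTwist_of_mult W K hK hH Wd Cd hWd ℓ hm⟩

/-! ## §2 The door: Kim–Nakamura-shaped implication + Kurihara supply ⟹ the socket's `hlowTw` -/

/-- **LOW₀ FOR THE TWIST FROM THE KURIHARA ROAD (Transfer of crux card `kurihara-lower-half`, BY NAME).**  Fix the prime `p` and a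
predicate `Kur X Dt ms` on (curve, modular parametrisation, plus-symbol table) — in the card: «some Kurihara number `δ_n` of `(X, p)` built
from `ms` is a `p`-adic unit».  ASSUME (displayed, not asserted): `hKN`, the Kim–Nakamura-shaped implication (sketch §2
`KimNakamuraToLowerHalf` at `p`: for `X/ℚ` globally minimal, `7 < p`, `X` additive at `p`, `ρ̄_{X,p}` onto, `p ∤ ∏ c_ℓ(X)`,
`p ∤ (ℓ−1)(ℓ+1)` at every multiplicative `ℓ`, `p ∤ c(Dt)`, `r_an(X) = 0`, `Re{∞,r}_{f} = ms(r)·Ω⁺_X`, and `Kur X Dt ms` ⟹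
`Typed.MissingLowerBoundAt X p`); `hC`, the C⁺-shaped supply (sketch §2 `KuriharaNonvanishingRankZeroAdditive` at `p`: every non-CM additive
analytic-rank-`0` `X` with `ρ̄` onto and such a table has `Kur X Dt ms`); the ♯ frame of §1; `7 < p`; Kim–Nakamura's non-anomaly binder at
the multiplicative primes OF `E` (`hmult`); and a Manin-good parametrisation with a rational plus symbol for every minimal twist model
(`hDt`).  THEN the socket's binder `hlowTw` holds VERBATIM: `Typed.MissingLowerBoundAt Wd p` for every globally minimal model
`Wd = Cd • E^{(d_K)}`.  Proof: §1 moves every binder of `hKN` from `E` to `Wd`; `hC` supplies `Kur`. [cite: KimNakamura2020, Thm 1.7, Rem. 1.8] -/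
theorem lowerHalf_twist_of_kuriharaRoad
    (Kur : ∀ (X : WeierstrassCurve ℚ) [NeZero (X.conductorNorm ℤ)],
      ModularParametrizationData X (X.conductorNorm ℤ) → (ℚ → ℚ) → Prop)
    (hKN : ∀ (X : WeierstrassCurve ℚ) [X.IsElliptic] [X.IsGloballyMinimal] [NeZero (X.conductorNorm ℤ)]
      (Dt : ModularParametrizationData X (X.conductorNorm ℤ)) (ms : ℚ → ℚ),
      7 < p → Addv X p → X.HasSurjectiveModNGaloisRep p → ¬ p ∣ X.tamagawaProduct →
      (∀ (ℓ : ℕ) [Fact ℓ.Prime], X.HasMultiplicativeReductionAtPrime ℓ → ¬ p ∣ (ℓ - 1) * (ℓ + 1)) →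
      ¬ (p : ℤ) ∣ Dt.c → X.analyticRank = 0 →
      (∀ r : ℚ, (modularSymbol Dt.f r).re = (ms r : ℝ) * X.realPeriodRat) →
      Kur X Dt ms → MissingLowerBoundAt X p)
    (hC : ∀ (X : WeierstrassCurve ℚ) [X.IsElliptic] [X.IsGloballyMinimal] [NeZero (X.conductorNorm ℤ)]
      (Dt : ModularParametrizationData X (X.conductorNorm ℤ)) (ms : ℚ → ℚ),
      5 ≤ p → ¬ X.HasCM → Addv X p → X.HasSurjectiveModNGaloisRep p → X.analyticRank = 0 →
      (∀ r : ℚ, (modularSymbol Dt.f r).re = (ms r : ℝ) * X.realPeriodRat) → Kur X Dt ms)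
    (hmod : hasEntireLFunction_rat) (h7 : 7 < p) (hadd : Addv W p) (hs : W.HasSurjectiveModNGaloisRep p) (hCM : ¬ W.HasCM)
    (htam : ¬ p ∣ W.tamagawaProduct)
    (hmult : ∀ (ℓ : ℕ) [Fact ℓ.Prime], W.HasMultiplicativeReductionAtPrime ℓ → ¬ p ∣ (ℓ - 1) * (ℓ + 1))
    (hK : IsImaginaryQuadratic K) (hodd : Odd (NumberField.discr K)) (hH : SatisfiesHeegnerHypothesis (W.conductorNorm ℤ) K)
    (hL : (W.quadraticTwist (NumberField.discr K : ℚ)).entireLFunction 1 ≠ 0)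
    (hDt : ∀ (Wd : WeierstrassCurve ℚ) [Wd.IsElliptic] [Wd.IsGloballyMinimal] [NeZero (Wd.conductorNorm ℤ)] (Cd : VariableChange ℚ),
      Cd • W.quadraticTwist (NumberField.discr K : ℚ) = Wd →
      ∃ (Dt' : ModularParametrizationData Wd (Wd.conductorNorm ℤ)) (ms : ℚ → ℚ),
        ¬ (p : ℤ) ∣ Dt'.c ∧ ∀ r : ℚ, (modularSymbol Dt'.f r).re = (ms r : ℝ) * Wd.realPeriodRat) :
    ∀ (Wd : WeierstrassCurve ℚ) [Wd.IsElliptic] [Wd.IsGloballyMinimal] (Cd : VariableChange ℚ),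
      Cd • W.quadraticTwist (NumberField.discr K : ℚ) = Wd → MissingLowerBoundAt Wd p := by
  intro Wd _ _ Cd hWd
  have hp2 : p ≠ 2 := by omega
  have hp5 : 5 ≤ p := by omega
  haveI : NeZero (Wd.conductorNorm ℤ) := ⟨(Wd.conductorNorm_pos_holds).ne'⟩
  obtain ⟨hCMd, haddd, hr0, hsd, htamd, hmultd⟩ :=
    twist_binders_of_frame W p K hmod hp2 hadd hs hCM htam hK hodd hH hL Wd Cd hWd
  obtain ⟨Dt', ms, hc', hms⟩ := hDt Wd Cd hWd
  have hmult' : ∀ (ℓ : ℕ) [Fact ℓ.Prime], Wd.HasMultiplicativeReductionAtPrime ℓ → ¬ p ∣ (ℓ - 1) * (ℓ + 1) :=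
    fun ℓ _ hm ↦ hmult ℓ (hmultd ℓ hm)
  exact hKN Wd Dt' ms h7 haddd hsd htamd hmult' hc' hr0 hms (hC Wd Dt' ms hp5 hCMd haddd hsd hr0 hms)

/-! ## §3 The frame corollary through the socket p638284 -/

/-- **KOLYVAGIN'S CONJECTURE MOD `p` AT A ♯ FRAME WITH `p > 7` FROM LOW₁ AND THE KURIHARA ROAD.**  The ♯ frame of KPA′ (globally minimal
non-CM `E`, `p` additive with `ρ̄` onto, `p ∤ ∏ c_ℓ`, `r_an(E) = 1`; `K` imaginary quadratic, `d_K` odd, `d_K < −4`, Heegner for `N_E`,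
`L(E^{(d_K)},1) ≠ 0`; `(Dt, β, ι)` with `4N ∣ β² − d_K`, `p ∤ c(Dt)`), with `7 < p` and Kim–Nakamura's non-anomaly binder at the
multiplicative primes; the published inputs of the socket (Gross–Zagier, Kolyvagin, Kolyvagin's bound, GZK, modularity, McCallum Cor. 5.6);
LOW₁ for `E` (`hlow`); and the Kurihara road of §2 (`hKN`, `hC`, `hDt`).  THEN some Kolyvagin–Heegner datum at some Kolyvagin level
(square-free product of Zhang–Kolyvagin primes) has a non-zero mod-`p` class — the conclusion of KPA′ and of
`stub_kolyvaginPrimitiveAboveBottom` at this frame.  `= exists_kolyvaginClass_ne_zero_of_lowerHalves` with `hlowTw := §2`.  CONDITIONAL on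
every binder; nothing is booked. [cite: KimNakamura2020, Thm 1.7] [cite: JetchevSkinnerWan2017, §7.4.3] [cite: McCallumLMS1991, §5 Cor. 5.6] -/
theorem exists_kolyvaginClass_ne_zero_of_lowerHalf_of_kuriharaRoad [NeZero (W.conductorNorm ℤ)]
    (Dt : ModularParametrizationData W (W.conductorNorm ℤ)) (β : ℤ) (ι : K →+* ℂ)
    -- published inputs (named facts of the tree)
    (hGZ : gross_zagier (W.conductorNorm ℤ) W K) (hKo : kolyvagin (W.conductorNorm ℤ) W K)
    (hKoB : Kolyvagin1990_padicValNat_card_sha_le (W.conductorNorm ℤ) W K)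
    (hGZK : rank_eq_analyticRank_of_analyticRank_le_one) (hmod : hasEntireLFunction_rat)
    (hMc : McCallum1991_padicValNat_card_sha_primary_add_le_of_globalDivisibility)
    -- the Kurihara road (displayed, not asserted)
    (Kur : ∀ (X : WeierstrassCurve ℚ) [NeZero (X.conductorNorm ℤ)],
      ModularParametrizationData X (X.conductorNorm ℤ) → (ℚ → ℚ) → Prop)
    (hKN : ∀ (X : WeierstrassCurve ℚ) [X.IsElliptic] [X.IsGloballyMinimal] [NeZero (X.conductorNorm ℤ)]
      (Dt : ModularParametrizationData X (X.conductorNorm ℤ)) (ms : ℚ → ℚ),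
      7 < p → Addv X p → X.HasSurjectiveModNGaloisRep p → ¬ p ∣ X.tamagawaProduct →
      (∀ (ℓ : ℕ) [Fact ℓ.Prime], X.HasMultiplicativeReductionAtPrime ℓ → ¬ p ∣ (ℓ - 1) * (ℓ + 1)) →
      ¬ (p : ℤ) ∣ Dt.c → X.analyticRank = 0 →
      (∀ r : ℚ, (modularSymbol Dt.f r).re = (ms r : ℝ) * X.realPeriodRat) →
      Kur X Dt ms → MissingLowerBoundAt X p)
    (hC : ∀ (X : WeierstrassCurve ℚ) [X.IsElliptic] [X.IsGloballyMinimal] [NeZero (X.conductorNorm ℤ)]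
      (Dt : ModularParametrizationData X (X.conductorNorm ℤ)) (ms : ℚ → ℚ),
      5 ≤ p → ¬ X.HasCM → Addv X p → X.HasSurjectiveModNGaloisRep p → X.analyticRank = 0 →
      (∀ r : ℚ, (modularSymbol Dt.f r).re = (ms r : ℝ) * X.realPeriodRat) → Kur X Dt ms)
    (hDt : ∀ (Wd : WeierstrassCurve ℚ) [Wd.IsElliptic] [Wd.IsGloballyMinimal] [NeZero (Wd.conductorNorm ℤ)] (Cd : VariableChange ℚ),
      Cd • W.quadraticTwist (NumberField.discr K : ℚ) = Wd →
      ∃ (Dt' : ModularParametrizationData Wd (Wd.conductorNorm ℤ)) (ms : ℚ → ℚ),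
        ¬ (p : ℤ) ∣ Dt'.c ∧ ∀ r : ℚ, (modularSymbol Dt'.f r).re = (ms r : ℝ) * Wd.realPeriodRat)
    -- the frame
    (h7 : 7 < p) (hadd : Addv W p) (hs : W.HasSurjectiveModNGaloisRep p) (hCM : ¬ W.HasCM)
    (htam : ¬ p ∣ W.tamagawaProduct)
    (hmult : ∀ (ℓ : ℕ) [Fact ℓ.Prime], W.HasMultiplicativeReductionAtPrime ℓ → ¬ p ∣ (ℓ - 1) * (ℓ + 1))
    (hr : W.analyticRank = 1)
    (hK : IsImaginaryQuadratic K) (hodd : Odd (NumberField.discr K)) (hlt : NumberField.discr K < -4)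
    (hH : SatisfiesHeegnerHypothesis (W.conductorNorm ℤ) K)
    (hL : (W.quadraticTwist (NumberField.discr K : ℚ)).entireLFunction 1 ≠ 0)
    (hβ : (4 * (W.conductorNorm ℤ : ℤ)) ∣ β ^ 2 - NumberField.discr K) (hc : ¬ (p : ℤ) ∣ Dt.c)
    -- LOW₁ for `E` (the card is LOW₀-only)
    (hlow : MissingLowerBoundAt W p) :
    ∃ (n : ℕ) (d : KolyvaginHeegnerData Dt β ι n),
      KolyvaginDescent.KolSupp (Zhang2014.IsKolyvaginPrime (W.conductorNorm ℤ) W K p) n ∧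
        d.kolyvaginClass hp.out 1 ≠ 0 :=
  exists_kolyvaginClass_ne_zero_of_lowerHalves W p K Dt β ι hGZ hKo hKoB hGZK hmod hMc (by omega) hadd hs hCM htam hr hK hodd
    hlt hH hL hβ hc hlow
    (lowerHalf_twist_of_kuriharaRoad W p K Kur hKN hC hmod h7 hadd hs hCM htam hmult hK hodd hH hL hDt)

end Summit.BirchSwinnertonDyer.BirchSwinnertonDyer.Theorems.AdditiveKoly.KuriharaRoad

end
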